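import Summits.HodgeConjecture.CorCM.HypLiu418.A3Liu418FaceTypes
import Summits.HodgeConjecture.CorCM.HypLiu418.A3Liu418MainGaloisGlue
import Summits.HodgeConjecture.HodgeConjecture.Theorems.HCCMUnconditionalH411
import Summits.HodgeConjecture.CorCM.HypLiu418.A3Liu418BettiThetaModelAtPlace
import Summits.HodgeConjecture.CorCM.HypLiu418.A3Liu418PinBettiPinningOfLemma24Proj
import Summits.HodgeConjecture.HodgeConjecture.Theorems.A3Liu418EtaleComparisonAtFace
import Literature.AlgebraicGeometry.ShimuraVarieties.UnitaryShimuraCanonicalModelUniqueProofs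
import Literature.NumberTheory.Automorphic.Liu2021.Lemma24OfJacobianDimension
import Literature.RepresentationTheory.AdmissibleDirectSumMultiplicityOne
import Literature.NumberTheory.Automorphic.Liu2021.Prop413MultLeOneOfAsPrinted
import Literature.NumberTheory.Automorphic.Liu2021.AppendixC.OmegaHomPullback
import Literature.NumberTheory.Automorphic.Liu2021.AppendixC.OmegaHomBettiComparisonRank
import Summits.HodgeConjecture.HodgeConjecture.Theorems.A3Liu413SepWeightOneAt
import HarnessLib

/-!
# [Liu 2021, Prop 4.13 ⇒ Thm 4.15 proof l. 2185] MULT1 AT THE FACE of the headline — multiplicity `≤ 1` of `ι_ℓ∘ω(ν,ε,χ)` in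
# `ℚ_ℓ^{ac} ⊗ H¹_ét(A_∞)`, i.e. the a3_liu418 v15 registry slot `stub_MULT1`, from the route item `H413` alone

Cell `hodgecm-mathlib` (D-0151), fan A, crux item hLiu418 = stmt-HodgeConjecture-24832 (route `HCCMUnconditional`), skeleton
`Cruxes/HLiu418/Lines/a3_liu418.lean` v15 (A-plan1 g6; director g4 RULINGS s71 «(S)-split, (β) per-`f` transfer under MULT1; MULT1 is NOT a
new fact row — bridge from row III-J3a» and s73 (3) «O2: one Schur proof for all faces; B-p14 writes `sep_weightOne_at (a)`»).  PROVER FILE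
(seat A-p09 g5; `--supports stmt-HodgeConjecture-24832`): THEOREMS ONLY, sorry-free, axioms ⊆ {propext, Classical.choice, Quot.sound}, no
definition, no named fact, no instance; namespace `Summit.HodgeConjecture.CorCM.Lines.A3Liu418` (the line's, as `A3Liu418EtaleComparisonAtFace`).

PRINT (Y. Liu, *Fourier–Jacobi cycles and arithmetic relative trace formula*, Camb. J. Math. 9 (2021) = arXiv:2102.11518, `FJcycle.tex`):
proof of Thm 4.15, l. 2185 «By Proposition 4.13, [the `ω(μ,ε,χ)`-part of `H¹`] … is of dimension `1`»; Prop 4.13 (l. 2110–2131) decomposes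
`H¹_{B,τ'}(A_∞, ℂ) ≃ ⊕ ω(μ,ε,χ)` over the admissible weight-one triples, each ONCE; §4.3 l. 2152–2168 carries it to `H¹_ét ⊗ ℚ_ℓ^{ac}` by the
comparison isomorphism.  Hence `Hom_{ℚ_ℓ^{ac}[𝔾]}(ι_ℓ∘ω(ν,ε,χ), ℚ_ℓ^{ac} ⊗ H¹_ét(A_∞))` has `ℚ_ℓ^{ac}`-rank `≤ 1`: any two of its elements are
proportional once one is non-zero (the LINE FORM `Mult1OmegaHom` of v15, consumed by the (β) glue `thm415FrobeniusAtFace_of_split`).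

ROUTE («O2», Schur on the line's own étale Betti theta model — ONE proof for ALL faces, at place and off place):
* §1 GENERIC over `(C, U, X, ι')`: `rank_omegaHom_le_one_of_etaleThetaDecomposition` — from `EtaleThetaDecomposition U ℓ X ι'` (a Betti
  comparison `(H, rhoB) ≃ₛₗ ℚ_ℓ^{ac} ⊗ H¹_ét` + `H ≃ ⊕_t ω_t` over ALL labelled admissible triples `AdmTripleAll U`, ✔ `A3Liu418EtaleItems`), the
  summands irreducible-or-zero / smooth / admissible, pairwise non-isomorphic, and a compact open subgroup: Schur's lemma for irreducible admissible
  representations in Hom-space form (✔ `Literature.RepresentationTheory.AdmissibleDirectSum.rank_intertwiningMap_le_one_of_equivariant_directSum`,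
  [Bump1997, Prop. 4.2.4]) on the Betti side, transported to the `ι'`-semilinear Hom-space by A-p08's ✔ `BettiComparison.rank_omegaHom_le_one`
  (`OmegaHomBettiComparisonRank`); `omegaHom_eq_of_rhoEt_eq` (the Hom-space depends on `X` through `rhoEt` only).
* §2 FACE of the headline (`ℭ_V = CV`, `T_V = TV`, `muConj 𝕌_V @ a = UV`, ✔ `A3Liu418Items`): `admTripleAll_UV_eq_of_equiv` = separation of the
  labelled admissible summands of `muConj 𝕌_V` at an ARBITRARY real scalar `a` (B-p14's ✔ `eps_eq_of_sep_weightOne_at`, [Lem D.1 (1), (3)] + [Flath Thm 3]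
  + weak approximation, read through `μ ↦ μᶜ` and `ε`-honesty `exists_locF_eq_epsOf`); `rank_omegaHom_le_one_atFace` / `mult1OmegaHom_atFace` from [Def 4.11]
  (`Hyp411`: ✔ `def411AsPrinted_uniform_of_hyp411`, `isIrreducibleOrZero_rho_UV_of_hyp411`) and the line's `StubEtaleBettiModel`, for EVERY induced `X`
  («`IsInducedBy` pins `rhoEt`»: A-p18's ✔ k19 `IsInducedBy.rhoEt_eq_etHeckeRep`).
* §3 KEYED ON THE ROUTE ITEM `H413` ALONE: `etaleBettiModel_of_h413` rebuilds `StubEtaleBettiModel` from `h413` with every other slot ✔ by name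
  (P at place: A-p06 `bettiThetaModelAtPlace_of_hyp413_of_pinning` over A-p18 C2 `pinBettiPinning_of_lemma24Proj` ∘ A-p17 F6
  `albanese_bettiOne_pullback_bijective_of_isProjectiveOver`; P off place: `stubBettiThetaModelOffPlace_of_h413_of_unique_of_lemma24Proj` with row I-4 ✔
  `canonicalModel_unique_printed_holds`; VI-2″: A-p16 ✔ `stubEtaleComparisonAtFace_holds`), and **`mult1AtFace_of_h413 (h413 : …Theses.HCCMUnconditional.H413)`**
  = v15's `Mult1AtFace` body token for token (slot fill `stub_MULT1 := fun h413 => mult1AtFace_of_h413 h413`, η only; slot-tested by paste against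
  A-plan1's dc0253fc :526/:672 texts, rc 0).
SOURCING / BOOKS: [Prop 4.13] enters as `h413` (at the floor `h413 := Hyp413Closing.H413_of_facts hdict hJ3a hc hD3`, so this IS the bridge from row
III-J3a the ruling asks for); [Def 4.11] as the CLOSED item `H411_proof`; everything else is a tree theorem.  NO new named fact (books ±0); `H413` and
`hDel` are the only printed citations this file leans on, as hypotheses.  HC_CM is proved only modulo the 7 printed citations (`hDel`, `h21`, `hLiu418`,
`h411`, `h413`, `hD3`, `hD1''`) until rung 0 closes; this file discharges none of them.

## References
* [Liu2021] Y. Liu, Camb. J. Math. 9 (2021) = arXiv:2102.11518: Prop. 4.13 (FJcycle.tex l. 2110–2131, proof l. 2145); Thm. 4.15 proof l. 2185; §4.3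
  l. 2152–2168; Def. 4.11–4.12; Rem. 4.4; Thm. 4.18 (2) with proof l. 2270; App. D Lemma D.1 (1), (3); Lem. 2.4.
* [Bump1997] D. Bump, *Automorphic Forms and Representations*, CUP 1997, Prop. 4.2.4 (Schur's lemma for irreducible admissible representations).
* [SGA4Tome3] Exp. XI Thm. 4.4 (comparison); [Deligne1971TravauxShimura] 5.5 (uniqueness of canonical models) — through the ✔ rows VI-2″ / I-4.
* Tree: `AppendixC/OmegaHomBettiComparisonRank` (A-p08 p644563), `AppendixC/OmegaHomPullback` (A-p18 p644483), `Theorems/A3Liu413SepWeightOneAt`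
  (B-p14 p645003), `RepresentationTheory/AdmissibleDirectSumMultiplicityOne`, `CorCM/HypLiu418/A3Liu418{EtaleItems,Items,FaceTypes,MainGaloisGlue,
  BettiThetaModelAtPlace,PinBettiPinningOfLemma24Proj}`, `Theorems/A3Liu418EtaleComparisonAtFace`, `Theorems/HCCMUnconditionalH411`.
-/

set_option autoImplicit false

noncomputable section

namespace Summit.HodgeConjecture.CorCM.Lines.A3Liu418

open scoped TensorProduct DirectSum
open NumberField
open Literature.NumberTheory.Automorphic
open Literature.NumberTheory.Automorphic.Liu2021 Literature.NumberTheory.Automorphic.Liu2021.AppendixC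
open Literature.AlgebraicGeometry.Liu2021 (IsAdmissibleElement)
open Literature.RepresentationTheory


/-! ## §1 Generic layer over an Appendix-C datum `C`, uniform carriers `U`, an étale Hecke datum `X` and `ι'` -/

section Generic

variable {F₀ E₀ : Type} [Field F₀] [NumberField F₀] [IsTotallyReal F₀] [Field E₀] [NumberField E₀] [Algebra F₀ E₀]
  [IsTotallyComplex E₀] [Algebra.IsQuadraticExtension F₀ E₀] [IsCMField E₀]
variable {P5 : PropC5Data F₀ E₀} {isotropicAt : ℕ → Prop} {C : Sec42Data P5 isotropicAt}

omit [IsCMField E₀] in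
/-- **The Hom-space depends on `X` only through `X.rhoEt`.** [cite: Liu2021, §4.3 (FJcycle.tex l. 2162–2165)] -/
theorem omegaHom_eq_of_rhoEt_eq {ℓ : ℕ} [Fact ℓ.Prime] {X X' : C.EtaleHeckeDatum ℓ} (h : X.rhoEt = X'.rhoEt)
    (ι' : ℂ ≃+* AlgebraicClosure ℚ_[ℓ]) {W : Type} [AddCommGroup W] [Module ℂ W] (ρW : Representation ℂ C.G W) :
    X.omegaHom ι' ρW = X'.omegaHom ι' ρW := by
  ext f
  simp only [Sec42Data.EtaleHeckeDatum.mem_omegaHom_iff, h]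

/-- **Multiplicity at most one of an irreducible-or-zero `ρ` in `ℚ_ℓ^{ac} ⊗ H¹_ét(A_∞)`, from [Prop 4.13]'s theta decomposition
through the comparison** (`EtaleThetaDecomposition`) by Schur's lemma for irreducible admissible representations: the summands
`ω(μ,ε,χ)` over ALL labelled admissible triples are irreducible or zero, smooth, admissible and pairwise non-isomorphic, and `𝔾(𝔸_F^∞)`
has a compact open subgroup. [cite: Liu2021, Prop. 4.13 (FJcycle.tex l. 2110–2131), Thm. 4.15 proof l. 2185] [cite: Bump1997, Proposition 4.2.4] -/
theorem rank_omegaHom_le_one_of_etaleThetaDecomposition (U : UniformOmega C) (ℓ : ℕ) [Fact ℓ.Prime]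
    (X : C.EtaleHeckeDatum ℓ) (ι' : ℂ ≃+* AlgebraicClosure ℚ_[ℓ]) (hdec : EtaleThetaDecomposition U ℓ X ι')
    (hirr : ∀ t : AdmTripleAll U, IsIrreducibleOrZero (U.rho t.μ t.hμ t.ε t.χ))
    (hadm : ∀ t : AdmTripleAll U, IsSmoothRep (U.rho t.μ t.hμ t.ε t.χ) ∧ IsAdmissibleRep (U.rho t.μ t.hμ t.ε t.χ))
    (hsep : ∀ s t : AdmTripleAll U, Nontrivial (U.omega s.μ s.hμ s.ε s.χ) →
      (∃ f : U.omega s.μ s.hμ s.ε s.χ ≃ₗ[ℂ] U.omega t.μ t.hμ t.ε t.χ,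
        ∀ (g : C.G) (v : U.omega s.μ s.hμ s.ε s.χ), f (U.rho s.μ s.hμ s.ε s.χ g v) = U.rho t.μ t.hμ t.ε t.χ g (f v)) →
      s = t)
    (hK : ∃ K : Subgroup C.G, IsOpenCompact K)
    {W : Type} [AddCommGroup W] [Module ℂ W] (ρ : Representation ℂ C.G W) (hρ : IsIrreducibleOrZero ρ) :
    Module.rank (AlgebraicClosure ℚ_[ℓ]) ↥(X.omegaHom ι' ρ) ≤ 1 := by
  obtain ⟨H, _, _, rhoB, ⟨B⟩, Ψ, hΨ⟩ := hdec
  refine B.rank_omegaHom_le_one ρ ?_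
  by_cases hW : Nontrivial W
  · haveI := isIrreducible_of_isIrreducibleOrZero hρ hW
    refine AdmissibleDirectSum.rank_intertwiningMap_le_one_of_equivariant_directSum
      (σ := fun t : AdmTripleAll U => U.rho t.μ t.hμ t.ε t.χ) Ψ hΨ
      (fun t ht => isIrreducible_of_isIrreducibleOrZero (hirr t) ht)
      (fun t => isAdmissible_of_isSmoothRep_of_isAdmissibleRep (hadm t).1 (hadm t).2)
      (fun s t hs ⟨e⟩ => hsep s t hs ⟨e.toLinearEquiv, fun g v => ?_⟩) ?_
    · rw [Representation.Equiv.toLinearEquiv_apply, Representation.Equiv.toLinearEquiv_apply]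
      exact e.toIntertwiningMap.isIntertwining _ _ g v
    · obtain ⟨K, hKo, hKc⟩ := hK
      exact ⟨K, hKo, hKc⟩
  · haveI : Subsingleton W := not_nontrivial_iff_subsingleton.mp hW
    rw [rank_le_one_iff]
    exact ⟨0, fun f => ⟨0, by
      rw [smul_zero]
      exact Representation.IntertwiningMap.ext (LinearMap.ext fun v => by
        rw [Subsingleton.elim v 0, map_zero, map_zero])⟩⟩

end Generic

/-! ## §2 The face of the headline: `ℭ_V`, `muConj 𝕌_V` at `a`, every induced `X` -/

section Face

open HodgeCM.Model HodgeCM.Model.LiuIndex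
open Literature.AlgebraicGeometry.Motives (CMType)
open Summit.HodgeConjecture.CorCM.Model
open Literature.NumberTheory.GelbartRogawski1991.UnitaryDualPair (imagUnit imagUnitSq)
open Literature.NumberTheory.Automorphic.Liu2021.Def411WeilCarriers (locF)
open Summit.HodgeConjecture.CorCM.D2Bridge.MuKeyIdentLemD3DelRecConjOmegaEndT.PrintedCitationHypotheses (Hyp411)
open Literature.NumberTheory.Automorphic.IdeleClassGroup (galConj)

set_option synthInstance.maxHeartbeats 400000 in
set_option maxHeartbeats 8000000 in
/-- **Separation of the labelled admissible summands of `muConj 𝕌_V` at `a`** — B-p14's scalar-generic label rigidity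
`eps_eq_of_sep_weightOne_at` ([Lem D.1 (1), (3)] + Flath + weak approximation, ★ rows) read through the relabelling `μ ↦ μᶜ` (`muConj`:
`ω_{muConj 𝕌}(μ,ε,χ) = ω_𝕌(μᶜ,ε,χ)` by `rfl`, `epsOf e ↦ epsOf (−e)`), both `ε`-lines honest by admissibility (`exists_locF_eq_epsOf`), and
`μ ↦ μᶜ` injective. [cite: Liu2021, Thm. 4.18 (2) with proof l. 2270; App. D Lemma D.1 (1), (3); Def. 4.12; Rem. 4.4] -/
theorem admTripleAll_UV_eq_of_equiv
    (hDel : Literature.AlgebraicGeometry.ShimuraVarieties.UnitaryCanonicalModel.canonicalModel_exists_printed)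
    (F : HodgeCM.CMField) [IsGalois ℚ F] (h6 : 6 ≤ Module.finrank ℚ F) {ι₁ : F →+* ℂ} (V : HodgeCM.HermSpace3 F ι₁) (a : RealScalar F)
    (Φ : CMType F) (hΦ : ι₁ ∈ Φ.1) (s t : AdmTripleAll (UV hDel F V a Φ))
    (hs : Nontrivial ((UV hDel F V a Φ).omega s.μ s.hμ s.ε s.χ))
    (hst : ∃ f : (UV hDel F V a Φ).omega s.μ s.hμ s.ε s.χ ≃ₗ[ℂ] (UV hDel F V a Φ).omega t.μ t.hμ t.ε t.χ,
      ∀ (g : (CV hDel F V Φ).G) (v : (UV hDel F V a Φ).omega s.μ s.hμ s.ε s.χ),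
        f ((UV hDel F V a Φ).rho s.μ s.hμ s.ε s.χ g v) = (UV hDel F V a Φ).rho t.μ t.hμ t.ε t.χ g (f v)) :
    s = t := by
  obtain ⟨μs, hμs, hws, εs, ⟨es, hes, hεs⟩, χs⟩ := s
  obtain ⟨μt, hμt, hwt, εt, ⟨et, het, hεt⟩, χt⟩ := t
  dsimp only at hs hst hεs hεt
  -- both `ε`-lines are honest (admissible ⇒ `ε = epsOf (−e) = locF b`)
  obtain ⟨bs, hbs⟩ := Def411WeilCarriers.exists_locF_eq_epsOf ↥(maximalRealSubfield (HodgeCM.CMField.K F)) (HodgeCM.CMField.K F)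
    (imagUnitSq (HodgeCM.CMField.K F)) (2 * imagUnit (HodgeCM.CMField.K F))⁻¹ (-es)
  obtain ⟨bt, hbt⟩ := Def411WeilCarriers.exists_locF_eq_epsOf ↥(maximalRealSubfield (HodgeCM.CMField.K F)) (HodgeCM.CMField.K F)
    (imagUnitSq (HodgeCM.CMField.K F)) (2 * imagUnit (HodgeCM.CMField.K F))⁻¹ (-et)
  obtain ⟨hμ, hε, hχ⟩ := Summit.HodgeConjecture.HodgeConjecture.Theorems.eps_eq_of_sep_weightOne_at hDel F h6 V a Φ hΦ
    (galConj (IsCMField.complexConj (HodgeCM.CMField.K F)) μs) (galConj (IsCMField.complexConj (HodgeCM.CMField.K F)) μt)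
    hμs.galConj hμt.galConj hws.galConj_complexConj hwt.galConj_complexConj εs εt χs χt ⟨bs, hbs.trans hεs⟩ ⟨bt, hbt.trans hεt⟩ hs hst
  have hμ' : μs = μt := IdeleClassGroup.galConj_complexConj_injective hμ
  subst hμ' hε hχ
  rfl

set_option synthInstance.maxHeartbeats 400000 in
set_option maxHeartbeats 4000000 in
/-- **MULT1 AT THE FACE, for every irreducible-or-zero `ρ`**: rank `≤ 1` of `Hom_{ℚ_ℓ^{ac}[𝔾]}(ι∘ρ, ℚ_ℓ^{ac} ⊗ H¹_ét(A_∞))` at every face of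
the headline and every étale Hecke datum induced by the Albanese translates — from [Def 4.11] (`Hyp411`), the étale Betti theta model of the line
(`StubEtaleBettiModel`: [Prop 4.13] through the comparison) and the separation of the labelled summands (B-p14's `eps_eq_of_sep_weightOne_at`).
[cite: Liu2021, Prop. 4.13 (FJcycle.tex l. 2110–2131), Thm. 4.15 proof l. 2185; Def. 4.11] [cite: Bump1997, Proposition 4.2.4] -/
theorem rank_omegaHom_le_one_atFace (h411 : Hyp411) (hEB : StubEtaleBettiModel)
    (hDel : Literature.AlgebraicGeometry.ShimuraVarieties.UnitaryCanonicalModel.canonicalModel_exists_printed)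
    (F : HodgeCM.CMField) [IsGalois ℚ F] (h6 : 6 ≤ Module.finrank ℚ F) {ι₁ : F →+* ℂ} (V : HodgeCM.HermSpace3 F ι₁) (a : RealScalar F)
    (Φ : CMType F) (hΦ : ι₁ ∈ Φ.1) (ℓ : ℕ) [Fact ℓ.Prime] (X : (CV hDel F V Φ).EtaleHeckeDatum ℓ) (ι' : ℂ ≃+* AlgebraicClosure ℚ_[ℓ])
    (hX : X.IsInducedBy (TV hDel F h6 V Φ)) {W : Type} [AddCommGroup W] [Module ℂ W]
    (ρ : Representation ℂ (CV hDel F V Φ).G W) (hρ : IsIrreducibleOrZero ρ) :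
    Module.rank (AlgebraicClosure ℚ_[ℓ]) ↥(X.omegaHom ι' ρ) ≤ 1 := by
  -- the line's étale Betti theta model at this face and `(ℓ, ι')`, carried by SOME induced datum `X₀`
  obtain ⟨X₀, hX₀, hdec⟩ := hEB hDel F h6 V a Φ hΦ ℓ ι'
  -- `IsInducedBy` pins `rhoEt`, so `X` and `X₀` have the same Hom-spaces
  have hXX₀ : X.rhoEt = X₀.rhoEt := hX.rhoEt_eq_etHeckeRep.trans hX₀.rhoEt_eq_etHeckeRep.symm
  rw [omegaHom_eq_of_rhoEt_eq hXX₀]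
  refine rank_omegaHom_le_one_of_etaleThetaDecomposition (UV hDel F V a Φ) ℓ X₀ ι' hdec
    (fun t => isIrreducibleOrZero_rho_UV_of_hyp411 h411 hDel F h6 V a Φ hΦ t.μ t.hμ t.hw t.ε t.χ)
    (fun t => (def411AsPrinted_uniform_of_hyp411 h411 hDel F h6 V a Φ hΦ
      (galConj (IsCMField.complexConj (HodgeCM.CMField.K F)) t.μ) t.hμ.galConj t.hw.galConj_complexConj t.ε t.χ).2)
    (fun s t hs hst => admTripleAll_UV_eq_of_equiv hDel F h6 V a Φ hΦ s t hs hst)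
    ⟨(CV hDel F V Φ).S.K₀.1, (CV hDel F V Φ).S.K₀.2⟩ ρ hρ

set_option synthInstance.maxHeartbeats 400000 in
set_option maxHeartbeats 4000000 in
/-- **MULT1 AT THE FACE (the registered shape: A-plan1's `Mult1OmegaHom (ℭ_V) (muConj 𝕌_V @ a) ℓ X ι' ν hν` under the face prefix of
`Thm415FrobeniusAtFace`, unfolded)** — any two elements of `Hom_{ℚ_ℓ^{ac}[𝔾]}(ι∘ω(ν,ε,χ), ℚ_ℓ^{ac} ⊗ H¹_ét(A_∞))` are proportional once one is
non-zero.  From [Def 4.11] (`Hyp411`, item CLOSED: `H411_proof`), the line's étale Betti theta model (`StubEtaleBettiModel`, [Prop 4.13] = `h413` at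
place, + I-4/III-0 off place, through VI-2″) and the separation of the labelled summands (B-p14's scalar-generic `eps_eq_of_sep_weightOne_at`, [Lem D.1 (1), (3)]) — NO new named fact: the
multiplicity is Liu's «by Proposition 4.13 … of dimension 1» (l. 2185), here as Schur's lemma on the theta decomposition.
[cite: Liu2021, Prop. 4.13 (FJcycle.tex l. 2110–2131), Thm. 4.15 proof l. 2185; Def. 4.11; App. D Lem. D.1 (3)] [cite: Bump1997, Proposition 4.2.4] -/
theorem mult1OmegaHom_atFace (h411 : Hyp411) (hEB : StubEtaleBettiModel) :
    ∀ (hDel : Literature.AlgebraicGeometry.ShimuraVarieties.UnitaryCanonicalModel.canonicalModel_exists_printed)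
      (F : HodgeCM.CMField) [IsGalois ℚ F] (h6 : 6 ≤ Module.finrank ℚ F) {ι₁ : F →+* ℂ} (V : HodgeCM.HermSpace3 F ι₁) (a : RealScalar F)
      (Φ : CMType F) (_hΦ : ι₁ ∈ Φ.1) (ν : Literature.NumberTheory.Automorphic.IdeleClassGroup (F : Type) →ₜ* Circle)
      (hν : IdeleClassGroup.IsConjugateSymplectic (F : Type) ν) (_hw : IdeleClassGroup.HasWeight (F : Type) ν 1)
      (ℓ : ℕ) [Fact ℓ.Prime] (X : (CV hDel F V Φ).EtaleHeckeDatum ℓ) (ι' : ℂ ≃+* AlgebraicClosure ℚ_[ℓ]),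
      X.IsInducedBy (TV hDel F h6 V Φ) →
        3 ≤ (CV hDel F V Φ).n → IdeleClassGroup.HasWeight (F : Type) ν 1 →
          ∀ (ε : (UV hDel F V a Φ).Eps),
            (∃ e : (F : Type), IsAdmissibleElement (F : Type) hν.cmType.1 e ∧ (UV hDel F V a Φ).epsOf e = ε) →
            ∀ (χ : (UV hDel F V a Φ).Chi),
              ∀ f ∈ X.omegaHom ι' ((UV hDel F V a Φ).rho ν hν ε χ), ∀ g ∈ X.omegaHom ι' ((UV hDel F V a Φ).rho ν hν ε χ),
                f ≠ 0 → ∃ b : AlgebraicClosure ℚ_[ℓ], g = b • f := by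
  intro hDel F _ h6 ι₁ V a Φ hΦ ν hν _ ℓ _ X ι' hX _ hw ε _ χ f hf g hg hf0
  exact X.exists_eq_smul_of_rank_omegaHom_le_one ι' ((UV hDel F V a Φ).rho ν hν ε χ)
    (rank_omegaHom_le_one_atFace h411 hEB hDel F h6 V a Φ hΦ ℓ X ι' hX ((UV hDel F V a Φ).rho ν hν ε χ)
      (isIrreducibleOrZero_rho_UV_of_hyp411 h411 hDel F h6 V a Φ hΦ ν hν hw ε χ)) hf hf0 g hg

end Face

/-! ## §3 The closer keyed on the route item `H413` alone (every other input ★ by name) -/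

section OfH413

open HodgeCM.Model HodgeCM.Model.LiuIndex
open Literature.AlgebraicGeometry.Motives (CMType)
open Summit.HodgeConjecture.CorCM.Model
open Summit.HodgeConjecture.CorCM.D2Bridge.MuKeyIdentLemD3DelRecConjOmegaEndT.PrintedCitationHypotheses (Hyp411)
open Literature.AlgebraicGeometry.ShimuraVarieties.UnitaryCanonicalModel (canonicalModel_unique_printed_holds)

set_option synthInstance.maxHeartbeats 400000 in
set_option maxHeartbeats 8000000 in
/-- **The line's étale Betti theta model from the route item `H413`, every other slot ★ by name** (the skeleton's
`stub_etaleBettiModel_of (stub_bettiThetaModel_of (stub_bettiThetaModelAtPlace_of h413 stub_pinBettiPinning) (stub_bettiThetaModel_offPlace h413 I-4)) VI-2″`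
with its landed discharges: P at place = A-p06 `bettiThetaModelAtPlace_of_hyp413_of_pinning` over A-p18 C2 `pinBettiPinning_of_lemma24Proj` ∘ A-p17 F6
`albanese_bettiOne_pullback_bijective_of_isProjectiveOver`; P off place = A-p02/A-p18 `stubBettiThetaModelOffPlace_of_h413_of_unique_of_lemma24Proj` with row I-4
★ `canonicalModel_unique_printed_holds`; VI-2″ = A-p16 `stubEtaleComparisonAtFace_holds`). [cite: Liu2021, Prop. 4.13; §4.3 l. 2152–2160; Lem. 2.4]
[cite: Deligne1971TravauxShimura, 5.5] [cite: SGA4Tome3, Exp. XI Thm. 4.4] -/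
theorem etaleBettiModel_of_h413 (h413 : Summit.HodgeConjecture.HodgeConjecture.Theses.HCCMUnconditional.H413) : StubEtaleBettiModel := by
  intro hDel F _ h6 ι₁ V a Φ hΦ ℓ _ ι'
  -- the pinned Betti theta model at this face (at place: the pin itself; off place: transported along the model isomorphism)
  have hP : ∃ (τ' : (F : Type) →+* ℂ) (H : Type) (_ : AddCommGroup H) (_ : Module ℂ H) (rhoB : Representation ℂ (CV hDel F V Φ).G H),
      Nonempty ((CV hDel F V Φ).BettiPinning (TV hDel F h6 V Φ) τ' H rhoB) ∧ BettiThetaDecomposition (UV hDel F V a Φ) H rhoB := by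
    by_cases hemb : (NumberField.InfinitePlace.mk ι₁).embedding = ι₁
    · exact bettiThetaModelAtPlace_of_hyp413_of_pinning h413
        (pinBettiPinning_of_lemma24Proj
          Literature.NumberTheory.Automorphic.Liu2021.AppendixC.albanese_bettiOne_pullback_bijective_of_isProjectiveOver)
        hDel F h6 V hemb a Φ hΦ
    · exact stubBettiThetaModelOffPlace_of_h413_of_unique_of_lemma24Proj
        Literature.NumberTheory.Automorphic.Liu2021.AppendixC.albanese_bettiOne_pullback_bijective_of_isProjectiveOver h413
        canonicalModel_unique_printed_holds hDel F h6 V hemb a Φ hΦ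
  obtain ⟨τ', H, _, _, rhoB, ⟨B⟩, hdec⟩ := hP
  -- the comparison theorem at that pinning (row VI-2″)
  obtain ⟨X, cmp, _, hX, -⟩ := stubEtaleComparisonAtFace_holds hDel F h6 V Φ ℓ τ' ι' H rhoB B
  exact ⟨X, hX, H, _, _, rhoB, ⟨cmp⟩, hdec⟩

set_option synthInstance.maxHeartbeats 400000 in
set_option maxHeartbeats 8000000 in
/-- **MULT1 AT THE FACE FROM THE ROUTE ITEM `H413` ALONE** — the by-name closer of the a3_liu418 registry slot
`stub_MULT1 : H413 → Mult1AtFace` (A-plan1 v15; `Mult1AtFace` = the face closure of `Mult1OmegaHom (ℭ_V) (muConj 𝕌_V @ a) ℓ X ι' ν hν`, unfolded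
here token for token): for every `hDel`, every face `(F, ι₁, V, a, Φ)` with `ι₁ ∈ Φ`, every conjugate-symplectic weight-one `ν`, every `(ℓ, ι')` and every étale
Hecke datum `X` INDUCED by the Albanese translates, if `n ≥ 3` then for every `ν`-admissible `ε` and every `χ` any two elements of
`Hom_{ℚ_ℓ^{ac}[𝔾]}(ι'∘ω(ν,ε,χ), ℚ_ℓ^{ac} ⊗ H¹_ét(A_∞))` are proportional once one is non-zero.  SOURCING (director g4 s71 (1) / s73 (3), books ±0): [Prop 4.13] =
`h413` (at the floor `h413 := Hyp413Closing.H413_of_facts hdict hJ3a hc hD3`, so this IS the bridge from row III-J3a), [Def 4.11] = `H411_proof` (item CLOSED),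
[Lem D.1 (1), (3)] label rigidity = B-p14 `eps_eq_of_sep_weightOne_at`, VI-2″ / III-0 / I-4 ★ by name, Schur ★ `AdmissibleDirectSum`, comparison transfer A-p08 ★
`BettiComparison.rank_omegaHom_le_one`, `IsInducedBy` pins `rhoEt` A-p18 ★ k19.  NO new named fact.
[cite: Liu2021, Prop. 4.13 (FJcycle.tex l. 2110–2131), Thm. 4.15 proof l. 2185; Def. 4.11; App. D Lem. D.1 (1), (3); §4.3 l. 2152–2168] [cite: Bump1997, Proposition 4.2.4] -/
theorem mult1AtFace_of_h413 (h413 : Summit.HodgeConjecture.HodgeConjecture.Theses.HCCMUnconditional.H413) :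
    ∀ (hDel : Literature.AlgebraicGeometry.ShimuraVarieties.UnitaryCanonicalModel.canonicalModel_exists_printed)
      (F : HodgeCM.CMField) [IsGalois ℚ F] (h6 : 6 ≤ Module.finrank ℚ F) {ι₁ : F →+* ℂ} (V : HodgeCM.HermSpace3 F ι₁) (a : RealScalar F)
      (Φ : CMType F) (_hΦ : ι₁ ∈ Φ.1) (ν : Literature.NumberTheory.Automorphic.IdeleClassGroup (F : Type) →ₜ* Circle)
      (hν : IdeleClassGroup.IsConjugateSymplectic (F : Type) ν) (_hw : IdeleClassGroup.HasWeight (F : Type) ν 1)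
      (ℓ : ℕ) [Fact ℓ.Prime] (X : (CV hDel F V Φ).EtaleHeckeDatum ℓ) (ι' : ℂ ≃+* AlgebraicClosure ℚ_[ℓ]),
      X.IsInducedBy (TV hDel F h6 V Φ) →
        3 ≤ (CV hDel F V Φ).n → IdeleClassGroup.HasWeight (F : Type) ν 1 →
          ∀ (ε : (UV hDel F V a Φ).Eps),
            (∃ e : (F : Type), IsAdmissibleElement (F : Type) hν.cmType.1 e ∧ (UV hDel F V a Φ).epsOf e = ε) →
            ∀ (χ : (UV hDel F V a Φ).Chi),
              ∀ f ∈ X.omegaHom ι' ((UV hDel F V a Φ).rho ν hν ε χ), ∀ g ∈ X.omegaHom ι' ((UV hDel F V a Φ).rho ν hν ε χ),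
                f ≠ 0 → ∃ b : AlgebraicClosure ℚ_[ℓ], g = b • f :=
  mult1OmegaHom_atFace Summit.HodgeConjecture.HodgeConjecture.Theorems.H411_proof (etaleBettiModel_of_h413 h413)

end OfH413

end Summit.HodgeConjecture.CorCM.Lines.A3Liu418

end
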